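import Literature.MathematicalPhysics.QuantumFieldTheory.Balaban1983to89.T4ExpWindowSmallField
import Literature.MathematicalPhysics.QuantumFieldTheory.Balaban1983to89.T4QuatExpLog
import Literature.MathematicalPhysics.QuantumFieldTheory.Balaban1983to89.T4WilsonLinkAffine
import HarnessLib

/-!
# `UnitScaleTiltSU2NearCommuting` — NEARLY COMMUTING ELEMENTS OF `SU(2)` LIE NEAR ONE MAXIMAL TORUS: a finite family with pairwise commutators
# `dist1 [U_i, U_j] ≤ t³` is, after ONE global conjugation, `2t`-close to diagonal elements `diag(e^{iθ_i}, e^{−iθ_i})`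
# (route `UnitScaleTilt`, crux K1′ `MinimiserStabilityRegPr` stmt-QuantumFields-19200, small-member exit (α)(a), piece P3 «`RegPr` ↦ toron gauge», FILE 2 of 3)

Cell `ym3-torus` (YM ladder rung R3 = continuum SU(2) Yang–Mills on T³ — a RUNG, NOT the Clay problem: not d = 4, not infinite volume,
not a mass gap); width seat `ym3-torus-px19` (gen 12); helper `--supports stmt-QuantumFields-19200`.  THEOREMS ONLY (0 `def`, 0 `sorry`, default
heartbeats); Mathlib + the tree's quaternion model of `SU(2)` (✓`QuantumLattice.SU2Haar`: `quatMatrix`, `su2Quat`, `quatToSU2`; ✓`T4QuatExpLog.norm_quatMatrix`;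
✓`T4ExpWindowSmallField.dist1_eq_norm_su2Quat_sub_one`).

WHY.  FILE 1 (✓`UnitScaleTiltTorusWrapHolonomies`) puts a `δ`-flat configuration on `T^{(j)}` in the whole-torus axial gauge: everything is `O(N²δ)`-small except
the `d` families of WRAP variables, which are `O(N²δ)`-constant along their transverse tori and whose corner representatives `h_μ` pairwise `O(N²δ)`-COMMUTE.  A toron
is a configuration whose wrap variables lie in ONE maximal torus `{diag(e^{iθ}, e^{−iθ})}` of `SU(2)`.  This file supplies the group-theoretic step: nearly commuting
elements of `SU(2)` are simultaneously near-diagonalisable, with the SHARP cube-root modulus (✓`T4ShellMeasureToron.not_lipschitz_modulus`: no Lipschitz modulus exists).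

THE ARGUMENT (unit quaternions `q = q₀ + v`, `v ∈ ℝ³`).  `‖pq − qp‖² = 4(|u|²|v|² − (u·v)²)` (§2, Lagrange).  Pick the member `i₀` with the LONGEST vector part `u`, `|u| = r`.
If `r ≤ t`, every `v_i` is replaced by `|v_i|·e₁` (cost `≤ √2·|v_i| ≤ √2 t`).  If `r > t`, every `v_i` is ROTATED onto the axis `±u∕r` keeping its length (cost²
`≤ 2|v_i^⊥|² = ‖p q_i − q_i p‖²∕(2r²) ≤ t⁶∕(2t²)`, so cost `≤ t² ≤ t` for `t ≤ 1`); lengths are kept so the modified quaternions stay on the unit sphere with the SAME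
real parts.  All modified elements commute (collinear vector parts) and one explicit unit quaternion `w ∝ (1 + n₁) + n₃ j − n₂ k` conjugates the common axis `n`
(`n₁ ≥ 0` by the sign choice) onto `e₁ = i`, i.e. onto the diagonal torus `quatMatrix ⟨cos θ, sin θ, 0, 0⟩ = diag(e^{iθ}, e^{−iθ})` (§3).  For `t > 1` the claim is
trivial (`dist1 ≤ 2`).

* §1 the `SU(2)` ↔ unit-quaternion dictionary BY NAME (✓`T4HaarSU2Translate`, ✓`T4WilsonLinkAffine`, ✓`T4ExpWindowSmallField`) plus ★`dist1_commutator_eq_norm_sub`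
  (`dist1 (U V U⁻¹ V⁻¹) = ‖q_U q_V − q_V q_U‖`) and `dist1_mul_inv_eq_norm_sub` (`dist1 (U V⁻¹) = ‖q_U − q_V‖`);
* §2 quaternion algebra: ★`norm_sq_sub_comm` (Lagrange), ★★`exists_axis_projection` (rotate a vector part onto a unit axis, same length, cost² `≤ 2|v^⊥|²`),
  ★`axis_conj` (`w̃ · (c + s n) = (c + s e₁) · w̃`, `normSq w̃ = 2(1 + n₁)`), `coe_quatToSU2_cos_sin` (the diagonal torus, `= !![e^{iθ}, 0; 0, e^{−iθ}]`);
* §3 ★★★`exists_conj_near_diagonal` — `U : ι → SU(2)` (`ι` finite), `0 ≤ t`, `∀ i j, dist1 (U_i U_j U_i⁻¹ U_j⁻¹) ≤ t³` ⇒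
  `∃ W : SU(2), ∃ θ : ι → ℝ, ∀ i, dist1 (W U_i W⁻¹ · D(θ_i)⁻¹) ≤ 2t`, `D(θ) := quatToSU2 ⟨cos θ, sin θ, 0, 0⟩`.

HONEST SCOPE.  Compact-group bookkeeping; nothing of (α)(a)'s coercivity, `hT`, `hGF`, EX, `MinimiserStabilityRegPr` (19200) or the rung `YM3TorusSU2` is proved; no summit
statement is proved; the Yang–Mills mass gap is NOT proved.
References: [Balaban1985Averaging] (19) p. 21 (the invariant metric `|U − 1|` on the gauge group); [BrockerTomDieck1985] I (1.9)–(1.10) (`SU(2)` = unit quaternions), IV (2.2)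
(maximal tori are conjugate).
-/

noncomputable section

set_option autoImplicit false

open Quaternion
open scoped Matrix.Norms.L2Operator
open Literature.MathematicalPhysics.QuantumLattice (quatMatrix su2Quat quatToSU2 quatMatrix_mul quatMatrix_one quatMatrix_su2Quat quatMatrix_smul
  norm_su2Quat su2Quat_ne_zero coe_quatToSU2 quatToSU2_su2Quat)
open Literature.MathematicalPhysics.QuantumFieldTheory.Balaban1983to89
open Literature.MathematicalPhysics.QuantumFieldTheory.Balaban1983to89.T4QuatExpLog (norm_quatMatrix quatMatrix_sub)
open Literature.MathematicalPhysics.QuantumFieldTheory.Balaban1983to89.T4ExpWindowSmallField (dist1_eq_norm_su2Quat_sub_one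
  sq_components_of_norm_eq_one)
open Literature.MathematicalPhysics.QuantumFieldTheory.Balaban1983to89.T4HaarSU2Translate (su2Quat_mul su2Quat_one su2Quat_quatToSU2)
open Literature.MathematicalPhysics.QuantumFieldTheory.Balaban1983to89.T4WilsonLinkAffine (su2Quat_inv)
open Literature.MathematicalPhysics.QuantumFieldTheory.Balaban1983to89.T4CubeChartGnomonic (SU2)

namespace Summit.QuantumFields.YangMills.Theorems.SU2NearCommuting

/-! ## §1 The `SU(2)` ↔ unit-quaternion dictionary -/

/-! The dictionary letters `su2Quat_mul`, `su2Quat_one`, `su2Quat_quatToSU2` (✓`T4HaarSU2Translate`), `su2Quat_inv` (✓`T4WilsonLinkAffine`),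
`sq_components_of_norm_eq_one`, `dist1_eq_norm_su2Quat_sub_one` (✓`T4ExpWindowSmallField`) are REUSED BY NAME. -/

/-- `dist1 (U V⁻¹) = ‖q_U − q_V‖`: the invariant metric of the cell's `GaugeGroup SU(2)` IS the chordal metric of the unit sphere `S³ ⊂ ℍ`.
[cite: Balaban1985Averaging, (19) p.21] -/
theorem dist1_mul_inv_eq_norm_sub (U V : SU2) : dist1 (U * V⁻¹) = ‖su2Quat U - su2Quat V‖ := by
  rw [dist1_eq_norm_su2Quat_sub_one, su2Quat_mul, su2Quat_inv]
  have hVV : su2Quat V * star (su2Quat V) = 1 := by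
    rw [Quaternion.self_mul_star, Quaternion.normSq_eq_norm_mul_self, norm_su2Quat, mul_one, Quaternion.coe_one]
  have h : su2Quat U * star (su2Quat V) - 1 = (su2Quat U - su2Quat V) * star (su2Quat V) := by
    rw [sub_mul, hVV]
  rw [h, norm_mul, norm_star, norm_su2Quat, mul_one]

/-- ★ `dist1 (U V U⁻¹ V⁻¹) = ‖q_U q_V − q_V q_U‖`: the commutator distance is the norm of the quaternion commutator. [cite: Balaban1985Averaging, (19) p.21] -/
theorem dist1_commutator_eq_norm_sub (U V : SU2) :
    dist1 (U * V * U⁻¹ * V⁻¹) = ‖su2Quat U * su2Quat V - su2Quat V * su2Quat U‖ := by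
  have h : U * V * U⁻¹ * V⁻¹ = (U * V) * (V * U)⁻¹ := by rw [mul_inv_rev, mul_assoc]
  rw [h, dist1_mul_inv_eq_norm_sub, su2Quat_mul, su2Quat_mul]

/-! ## §2 Quaternion algebra: the commutator, the projection onto an axis, the conjugation of an axis onto `i` -/

/-- ★ **LAGRANGE**: `‖pq − qp‖² = 4(|u|²|v|² − (u·v)²)` for the vector parts `u, v` of `p, q` (`pq − qp = 2 u × v`). [cite: BrockerTomDieck1985, I (1.9)] -/
theorem norm_sq_sub_comm (p q : ℍ) :
    ‖p * q - q * p‖ ^ 2 = 4 * ((p.imI ^ 2 + p.imJ ^ 2 + p.imK ^ 2) * (q.imI ^ 2 + q.imJ ^ 2 + q.imK ^ 2)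
      - (p.imI * q.imI + p.imJ * q.imJ + p.imK * q.imK) ^ 2) := by
  rw [sq, ← Quaternion.normSq_eq_norm_mul_self, Quaternion.normSq_def']
  simp only [Quaternion.re_sub, Quaternion.imI_sub, Quaternion.imJ_sub, Quaternion.imK_sub, Quaternion.re_mul, Quaternion.imI_mul,
    Quaternion.imJ_mul, Quaternion.imK_mul]
  ring

/-- ★★ **PROJECTION OF A VECTOR PART ONTO A UNIT AXIS, KEEPING ITS LENGTH.**  For a unit axis `n ∈ ℝ³` and any quaternion `q = q₀ + v` there is a signed length `s`
(`s² = |v|²`, the sign of `v·n`) with `‖q − (q₀ + s·n)‖² ≤ 2(|v|² − (v·n)²) = 2|v^⊥|²` (`|v − s n|² = 2|v|(|v| − |v·n|) ≤ 2(|v| − |v·n|)(|v| + |v·n|)`).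
[cite: BrockerTomDieck1985, IV (2.2)] -/
theorem exists_axis_projection (n₁ n₂ n₃ : ℝ) (hn : n₁ ^ 2 + n₂ ^ 2 + n₃ ^ 2 = 1) (q : ℍ) :
    ∃ s : ℝ, s ^ 2 = q.imI ^ 2 + q.imJ ^ 2 + q.imK ^ 2 ∧
      ‖q - ⟨q.re, s * n₁, s * n₂, s * n₃⟩‖ ^ 2
        ≤ 2 * ((q.imI ^ 2 + q.imJ ^ 2 + q.imK ^ 2) - (q.imI * n₁ + q.imJ * n₂ + q.imK * n₃) ^ 2) := by
  set ℓ := Real.sqrt (q.imI ^ 2 + q.imJ ^ 2 + q.imK ^ 2) with hℓ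
  set d := q.imI * n₁ + q.imJ * n₂ + q.imK * n₃ with hd
  have hℓ0 : 0 ≤ ℓ := Real.sqrt_nonneg _
  have hℓ2 : ℓ ^ 2 = q.imI ^ 2 + q.imJ ^ 2 + q.imK ^ 2 := Real.sq_sqrt (by positivity)
  -- Lagrange: `|v|² − (v·n)² = |v × n|² ≥ 0`
  have hlag : (q.imI ^ 2 + q.imJ ^ 2 + q.imK ^ 2) - d ^ 2
      = (q.imI * n₂ - q.imJ * n₁) ^ 2 + (q.imI * n₃ - q.imK * n₁) ^ 2 + (q.imJ * n₃ - q.imK * n₂) ^ 2 := by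
    rw [hd]; linear_combination (-(q.imI ^ 2 + q.imJ ^ 2 + q.imK ^ 2)) * hn
  have hdℓ : |d| ≤ ℓ := abs_le_of_sq_le_sq (by nlinarith [hlag]) hℓ0
  obtain ⟨hdl, hdu⟩ := abs_le.mp hdℓ
  -- the distance of `v` to `s n` for `s = ±ℓ`
  have hdist : ∀ s : ℝ, ‖q - ⟨q.re, s * n₁, s * n₂, s * n₃⟩‖ ^ 2
      = (q.imI ^ 2 + q.imJ ^ 2 + q.imK ^ 2) - 2 * s * d + s ^ 2 * (n₁ ^ 2 + n₂ ^ 2 + n₃ ^ 2) := by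
    intro s
    rw [sq, ← Quaternion.normSq_eq_norm_mul_self, Quaternion.normSq_def', hd]
    simp only [Quaternion.re_sub, Quaternion.imI_sub, Quaternion.imJ_sub, Quaternion.imK_sub]
    ring
  by_cases hd0 : 0 ≤ d
  · refine ⟨ℓ, hℓ2, ?_⟩
    rw [hdist, hn]
    nlinarith
  · refine ⟨-ℓ, by rw [neg_sq, hℓ2], ?_⟩
    rw [hdist, hn]
    nlinarith

/-- ★ **CONJUGATING AN AXIS ONTO `i`.**  For a unit axis `n` the quaternion `w̃ = (1 + n₁) + n₃ j − n₂ k` satisfies `w̃·(c + s n) = (c + s i)·w̃` for all real `c, s`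
(so `w̃ n w̃⁻¹ = i` whenever `n₁ ≠ −1`). [cite: BrockerTomDieck1985, IV (2.2)] -/
theorem axis_conj (n₁ n₂ n₃ : ℝ) (hn : n₁ ^ 2 + n₂ ^ 2 + n₃ ^ 2 = 1) (c s : ℝ) :
    (⟨1 + n₁, 0, n₃, -n₂⟩ : ℍ) * ⟨c, s * n₁, s * n₂, s * n₃⟩ = (⟨c, s, 0, 0⟩ : ℍ) * ⟨1 + n₁, 0, n₃, -n₂⟩ := by
  ext
  · simp; ring
  · simp; linear_combination s * hn
  · simp; ring
  · simp; ring

/-- `‖w̃‖² = 2(1 + n₁)` for the conjugator of `axis_conj`. [cite: BrockerTomDieck1985, IV (2.2)] -/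
theorem normSq_axisConj (n₁ n₂ n₃ : ℝ) (hn : n₁ ^ 2 + n₂ ^ 2 + n₃ ^ 2 = 1) :
    Quaternion.normSq (⟨1 + n₁, 0, n₃, -n₂⟩ : ℍ) = 2 * (1 + n₁) := by
  rw [Quaternion.normSq_def']
  simp only
  linear_combination hn

/-- **THE DIAGONAL TORUS**: `quatToSU2 (cos θ + sin θ · i) = diag(e^{iθ}, e^{−iθ})`. [cite: BrockerTomDieck1985, IV (2.2)] -/
theorem coe_quatToSU2_cos_sin (θ : ℝ) :
    ((quatToSU2 ⟨Real.cos θ, Real.sin θ, 0, 0⟩ : SU2) : Matrix (Fin 2) (Fin 2) ℂ)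
      = !![Complex.exp (θ * Complex.I), 0; 0, Complex.exp (-(θ * Complex.I))] := by
  set dq : ℍ := ⟨Real.cos θ, Real.sin θ, 0, 0⟩ with hdq
  have h1 : ‖dq‖ = 1 := by
    have h : ‖dq‖ ^ 2 = 1 := by
      rw [sq, ← Quaternion.normSq_eq_norm_mul_self, Quaternion.normSq_def', hdq]
      simp only
      nlinarith [Real.cos_sq_add_sin_sq θ]
    nlinarith [norm_nonneg dq]
  rw [Literature.MathematicalPhysics.QuantumLattice.coe_quatToSU2_of_norm_eq_one h1, hdq]
  ext i j
  fin_cases i <;> fin_cases j <;> apply Complex.ext <;>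
    simp [quatMatrix, Complex.exp_re, Complex.exp_im]

/-! ## §3 Nearly commuting families are near one maximal torus, after a global conjugation -/

/-- ★★ **THE AXIS LEMMA.**  If every member of a family `U : ι → SU(2)` is `ε`-close (in `ℍ`) to the quaternion with the SAME real part and vector part `s_i · n`
on a COMMON unit axis `n` with `n₁ ≥ 0`, then one global conjugation `W = quatToSU2 w̃` (`w̃ = (1 + n₁) + n₃ j − n₂ k`, ✓`axis_conj`) puts the whole family
`ε`-close to the diagonal torus: `dist1 (W U_i W⁻¹ · D(θ_i)⁻¹) ≤ ε` with `cos θ_i = Re q_i`, `sin θ_i = s_i`. [cite: BrockerTomDieck1985, IV (2.2)] -/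
theorem exists_conj_near_diagonal_of_axis {ι : Type*} (U : ι → SU2) (n₁ n₂ n₃ : ℝ) (hn : n₁ ^ 2 + n₂ ^ 2 + n₃ ^ 2 = 1)
    (hn₁ : 0 ≤ n₁) (s : ι → ℝ) (hs : ∀ i, (su2Quat (U i)).re ^ 2 + s i ^ 2 = 1) {ε : ℝ}
    (hclose : ∀ i, ‖su2Quat (U i) - ⟨(su2Quat (U i)).re, s i * n₁, s i * n₂, s i * n₃⟩‖ ≤ ε) :
    ∃ (W : SU2) (θ : ι → ℝ), ∀ i,
      dist1 (W * U i * W⁻¹ * (quatToSU2 ⟨Real.cos (θ i), Real.sin (θ i), 0, 0⟩)⁻¹) ≤ ε := by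
  -- the conjugator
  set wt : ℍ := ⟨1 + n₁, 0, n₃, -n₂⟩ with hwt
  have hwt2 : Quaternion.normSq wt = 2 * (1 + n₁) := normSq_axisConj n₁ n₂ n₃ hn
  have hwt0 : wt ≠ 0 := by
    intro h
    have : Quaternion.normSq wt = 0 := by rw [h, map_zero]
    rw [hwt2] at this
    linarith
  have hnorm0 : ‖wt‖ ≠ 0 := norm_ne_zero_iff.mpr hwt0
  set w : ℍ := ‖wt‖⁻¹ • wt with hw
  have hWq : su2Quat (quatToSU2 wt) = w := su2Quat_quatToSU2 hwt0
  have hww : w * star w = 1 := by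
    rw [← hWq, Quaternion.self_mul_star, Quaternion.normSq_eq_norm_mul_self, norm_su2Quat, mul_one, Quaternion.coe_one]
  -- the angles
  refine ⟨quatToSU2 wt, fun i => Complex.arg ⟨(su2Quat (U i)).re, s i⟩, fun i => ?_⟩
  set c := (su2Quat (U i)).re with hc
  set z : ℂ := ⟨c, s i⟩ with hz
  have hz1 : ‖z‖ = 1 := by
    have h2 : ‖z‖ ^ 2 = 1 := by rw [Complex.sq_norm, Complex.normSq_apply, hz]; simp only; nlinarith [hs i]
    nlinarith [norm_nonneg z]
  have hz0 : z ≠ 0 := by intro h; rw [h, norm_zero] at hz1; exact zero_ne_one hz1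
  have hcos : Real.cos (Complex.arg z) = c := by rw [Complex.cos_arg hz0, hz1, div_one]
  have hsin : Real.sin (Complex.arg z) = s i := by rw [Complex.sin_arg, hz1, div_one]
  rw [hcos, hsin]
  -- the diagonal element and its quaternion
  set dq : ℍ := ⟨c, s i, 0, 0⟩ with hdq
  have hdq1 : ‖dq‖ = 1 := by
    have h2 : ‖dq‖ ^ 2 = 1 := by
      rw [sq, ← Quaternion.normSq_eq_norm_mul_self, Quaternion.normSq_def', hdq]
      simp only
      nlinarith [hs i]
    nlinarith [norm_nonneg dq]
  have hdq0 : dq ≠ 0 := by intro h; rw [h, norm_zero] at hdq1; exact zero_ne_one hdq1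
  have hDq : su2Quat (quatToSU2 dq) = dq := by rw [su2Quat_quatToSU2 hdq0, hdq1, inv_one, one_smul]
  -- `w q′ w* = dq`
  set q' : ℍ := ⟨c, s i * n₁, s i * n₂, s i * n₃⟩ with hq'
  have hconj : wt * q' = dq * wt := by rw [hwt, hq', hdq]; exact axis_conj n₁ n₂ n₃ hn c (s i)
  have hconj' : w * q' * star w = dq := by
    have h1 : w * q' = dq * w := by
      rw [hw, smul_mul_assoc, hconj, mul_smul_comm]
    rw [h1, mul_assoc, hww, mul_one]
  -- assemble
  rw [dist1_mul_inv_eq_norm_sub, su2Quat_mul, su2Quat_mul, su2Quat_inv, hWq, hDq, ← hconj']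
  have hfac : w * su2Quat (U i) * star w - w * q' * star w = w * (su2Quat (U i) - q') * star w := by
    rw [mul_sub, sub_mul]
  have hwn : ‖w‖ = 1 := by rw [← hWq]; exact norm_su2Quat _
  rw [hfac, norm_mul, norm_mul, norm_star, hwn, one_mul, mul_one]
  exact hclose i

/-- ★★★ **NEARLY COMMUTING ELEMENTS OF `SU(2)` ARE NEAR ONE MAXIMAL TORUS.**  For a finite family `U : ι → SU(2)` whose commutators satisfy `dist1 (U_i U_j U_i⁻¹ U_j⁻¹) ≤ t³`
(`t ≥ 0`) there are ONE `W ∈ SU(2)` and angles `θ_i` with `dist1 (W U_i W⁻¹ · D(θ_i)⁻¹) ≤ 2t` for all `i`, `D(θ) = quatToSU2 (cos θ + sin θ·i) = diag(e^{iθ}, e^{−iθ})`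
(✓`coe_quatToSU2_cos_sin`).  The cube root is sharp (✓`T4ShellMeasureToron.not_lipschitz_modulus`).  Proof: longest vector part `u` (`|u|² = r²`); `r² ≤ t²` ⇒ project on
the axis `i` (cost `≤ √2 t`); `r² > t²` ⇒ rotate onto `±u∕r` (cost² `≤ ‖pq − qp‖²∕(2r²) ≤ t⁴∕2`); then ✓`exists_conj_near_diagonal_of_axis`; `t > 1` trivial.
[cite: BrockerTomDieck1985, IV (2.2)] -/
theorem exists_conj_near_diagonal {ι : Type*} [Fintype ι] (U : ι → SU2) {t : ℝ} (ht : 0 ≤ t)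
    (hcomm : ∀ i j, dist1 (U i * U j * (U i)⁻¹ * (U j)⁻¹) ≤ t ^ 3) :
    ∃ (W : SU2) (θ : ι → ℝ), ∀ i,
      dist1 (W * U i * W⁻¹ * (quatToSU2 ⟨Real.cos (θ i), Real.sin (θ i), 0, 0⟩)⁻¹) ≤ 2 * t := by
  classical
  by_cases ht1 : 1 < t
  · refine ⟨1, fun _ => 0, fun i => ?_⟩
    rw [dist1_eq_norm_su2Quat_sub_one]
    calc ‖su2Quat _ - 1‖ ≤ ‖su2Quat _‖ + ‖(1 : ℍ)‖ := norm_sub_le _ _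
      _ ≤ 2 * t := by rw [norm_su2Quat, norm_one]; linarith
  have ht1' : t ≤ 1 := not_lt.mp ht1
  rcases isEmpty_or_nonempty ι with hι | hι
  · exact ⟨1, fun _ => 0, fun i => (IsEmpty.false i).elim⟩
  -- the quaternions
  set q : ι → ℍ := fun i => su2Quat (U i) with hq
  have hq1 : ∀ i, (q i).re ^ 2 + (q i).imI ^ 2 + (q i).imJ ^ 2 + (q i).imK ^ 2 = 1 :=
    fun i => sq_components_of_norm_eq_one (norm_su2Quat (U i))
  have hc : ∀ i j, ‖q i * q j - q j * q i‖ ≤ t ^ 3 := fun i j => by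
    have h := hcomm i j; rwa [dist1_commutator_eq_norm_sub] at h
  -- the member with the longest vector part
  obtain ⟨i₀, -, hi₀⟩ := Finset.exists_max_image (Finset.univ : Finset ι)
    (fun i => (q i).imI ^ 2 + (q i).imJ ^ 2 + (q i).imK ^ 2) Finset.univ_nonempty
  set r2 := (q i₀).imI ^ 2 + (q i₀).imJ ^ 2 + (q i₀).imK ^ 2 with hr2
  have hmax : ∀ i, (q i).imI ^ 2 + (q i).imJ ^ 2 + (q i).imK ^ 2 ≤ r2 := fun i => hi₀ i (Finset.mem_univ i)
  -- `X ≤ 2t` from `X² ≤ (2t)²`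
  have hroot : ∀ X : ℝ, 0 ≤ X → X ^ 2 ≤ 4 * t ^ 2 → X ≤ 2 * t := fun X hX h => by
    have h' : X ^ 2 ≤ (2 * t) ^ 2 := by linarith
    have := abs_le_of_sq_le_sq' h' (by linarith)
    linarith [abs_of_nonneg hX]
  by_cases hA : r2 ≤ t ^ 2
  · -- SHORT vector parts: project everything on the axis `i`
    have hax : ∀ i, ∃ s : ℝ, s ^ 2 = (q i).imI ^ 2 + (q i).imJ ^ 2 + (q i).imK ^ 2 ∧
        ‖q i - ⟨(q i).re, s * 1, s * 0, s * 0⟩‖ ≤ 2 * t := by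
      intro i
      obtain ⟨s, hs, hd⟩ := exists_axis_projection 1 0 0 (by norm_num) (q i)
      refine ⟨s, hs, hroot _ (norm_nonneg _) ?_⟩
      linarith [hmax i, sq_nonneg ((q i).imI * 1 + (q i).imJ * 0 + (q i).imK * 0), sq_nonneg t]
    choose s hs hd using hax
    have hs1 : ∀ i, (su2Quat (U i)).re ^ 2 + s i ^ 2 = 1 := fun i => by rw [hs i]; linarith [hq1 i]
    obtain ⟨W, θ, h⟩ := exists_conj_near_diagonal_of_axis U 1 0 0 (by norm_num) zero_le_one s hs1 hd
    exact ⟨W, θ, h⟩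
  · -- LONG vector part at `i₀`: rotate everything onto the axis `± u ∕ r`
    have hA' : t ^ 2 < r2 := not_le.mp hA
    have hr2pos : 0 < r2 := lt_of_le_of_lt (sq_nonneg t) hA'
    set r := Real.sqrt r2 with hr
    have hr0 : 0 < r := Real.sqrt_pos.mpr hr2pos
    have hrr : r ^ 2 = r2 := Real.sq_sqrt hr2pos.le
    -- sign choice making the first axis component non-negative
    set σ : ℝ := if 0 ≤ (q i₀).imI then 1 else -1 with hσ
    have hσ2 : σ ^ 2 = 1 := by rw [hσ]; split_ifs <;> norm_num
    have hσu : 0 ≤ σ * (q i₀).imI := by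
      rw [hσ]; split_ifs with h
      · linarith
      · have h' := not_le.mp h
        linarith
    set n₁ := σ / r * (q i₀).imI with hn₁
    set n₂ := σ / r * (q i₀).imJ with hn₂
    set n₃ := σ / r * (q i₀).imK with hn₃
    have hσr : (σ / r) ^ 2 = r2⁻¹ := by rw [div_pow, hσ2, hrr, one_div]
    have hn : n₁ ^ 2 + n₂ ^ 2 + n₃ ^ 2 = 1 := by
      have h : n₁ ^ 2 + n₂ ^ 2 + n₃ ^ 2 = (σ / r) ^ 2 * r2 := by rw [hn₁, hn₂, hn₃, hr2]; ring
      rw [h, hσr, inv_mul_cancel₀ hr2pos.ne']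
    have hn₁0 : 0 ≤ n₁ := by
      rw [hn₁, div_mul_eq_mul_div]; exact div_nonneg hσu hr0.le
    clear_value n₁ n₂ n₃
    have hax : ∀ i, ∃ s : ℝ, s ^ 2 = (q i).imI ^ 2 + (q i).imJ ^ 2 + (q i).imK ^ 2 ∧
        ‖q i - ⟨(q i).re, s * n₁, s * n₂, s * n₃⟩‖ ≤ 2 * t := by
      intro i
      obtain ⟨s, hs, hd⟩ := exists_axis_projection n₁ n₂ n₃ hn (q i)
      refine ⟨s, hs, hroot _ (norm_nonneg _) ?_⟩
      -- `|v|² − (v·n)² = ‖p q − q p‖² ∕ (4 r²)` (Lagrange) `≤ t⁶ ∕ (4 r²)`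
      set S := (q i).imI ^ 2 + (q i).imJ ^ 2 + (q i).imK ^ 2 with hS
      set D := (q i₀).imI * (q i).imI + (q i₀).imJ * (q i).imJ + (q i₀).imK * (q i).imK with hD
      set X := ‖q i - ⟨(q i).re, s * n₁, s * n₂, s * n₃⟩‖ with hX
      have hlag : ‖q i₀ * q i - q i * q i₀‖ ^ 2 = 4 * (r2 * S - D ^ 2) := by
        rw [norm_sq_sub_comm, ← hr2]
      have hct : ‖q i₀ * q i - q i * q i₀‖ ^ 2 ≤ (t ^ 3) ^ 2 := pow_le_pow_left₀ (norm_nonneg _) (hc i₀ i) 2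
      have hdot : (q i).imI * n₁ + (q i).imJ * n₂ + (q i).imK * n₃ = σ / r * D := by rw [hn₁, hn₂, hn₃, hD]; ring
      have hkey : (S - ((q i).imI * n₁ + (q i).imJ * n₂ + (q i).imK * n₃) ^ 2) * (4 * r2) = ‖q i₀ * q i - q i * q i₀‖ ^ 2 := by
        rw [hdot, mul_pow, hσr, hlag]
        field_simp
      have h1 : X ^ 2 * (4 * r2) ≤ 2 * (t ^ 3) ^ 2 := by
        have h := mul_le_mul_of_nonneg_right hd (by linarith : (0 : ℝ) ≤ 4 * r2)
        rw [mul_assoc, hkey] at h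
        linarith
      -- `2 t⁶ ≤ 2 r2 t⁴` since `t² < r2`
      have h2 : 2 * (t ^ 3) ^ 2 ≤ 2 * r2 * t ^ 4 := by
        have h := mul_le_mul_of_nonneg_left hA'.le (pow_nonneg ht 4)
        have e : (t ^ 3) ^ 2 = t ^ 4 * t ^ 2 := by ring
        rw [e]
        linarith [h]
      have h3 : X ^ 2 * 4 ≤ 2 * t ^ 4 := by
        refine le_of_mul_le_mul_right ?_ hr2pos
        calc X ^ 2 * 4 * r2 = X ^ 2 * (4 * r2) := by ring
          _ ≤ 2 * r2 * t ^ 4 := h1.trans h2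
          _ = 2 * t ^ 4 * r2 := by ring
      have h4 : t ^ 4 ≤ t ^ 2 := pow_le_pow_of_le_one ht ht1' (by norm_num)
      linarith [sq_nonneg t]
    choose s hs hd using hax
    have hs1 : ∀ i, (su2Quat (U i)).re ^ 2 + s i ^ 2 = 1 := fun i => by rw [hs i]; linarith [hq1 i]
    obtain ⟨W, θ, h⟩ := exists_conj_near_diagonal_of_axis U n₁ n₂ n₃ hn hn₁0 s hs1 hd
    exact ⟨W, θ, h⟩

end Summit.QuantumFields.YangMills.Theorems.SU2NearCommuting

end
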